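import Mathlib.Analysis.Calculus.Deriv.Inv
import Mathlib.Analysis.Calculus.DifferentialForm.Basic
import Literature.Geometry.Symplectic.ExactNoJSpheres
import Literature.Geometry.Symplectic.PlanarExactDensityDecay

/-!
# Stub `stub_sphereDetVanishes` of line `cross-cap-laurent` (crux `GromovRecognitionRelEnd`, item stmt-SmoothPoincare4-11009)

A smooth map `ℂP¹ → ℂ`, given by its two affine charts `g, h : ℂ → ℂ` (`h z = g (1/z)` for
`z ≠ 0`), whose Jacobian determinant `det Dg` is everywhere `≥ 0`, has `det Dg ≡ 0`.

Proof (the Stokes-with-cut-off pattern of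
`Literature.Geometry.Symplectic.jSphere_const_of_exact_tame`): the `1`-form `β = g₁ dg₂`
(`g₁ = re ∘ g`, `g₂ = im ∘ g`) is `C^∞` on `ℂ`, `dβ(1, i) = dg₁ ∧ dg₂ (1, i) = det Dg`
(`d dg₂ = 0`), and through the chart `z ↦ 1/z` (`g = h ∘ inv` near `∞`, `h` and `Dh` bounded on
the closed unit disc) `|β_z(w)| ≤ C ‖w‖ / ‖z‖²` for `‖z‖ ≥ 1`; the decay lemma
`Literature.Geometry.Symplectic.extDeriv_apply_eq_zero_of_nonneg_of_decay` (Stokes for `χ_R β`,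
`R → ∞`) then gives `dβ(1, i) ≡ 0`.
-/

noncomputable section

-- the prescribed namespace `Summit.<P>.<Sub>.…` duplicates `SmoothPoincare4` (P = Sub)
set_option linter.dupNamespace false

open scoped ContDiff Topology
open Set Metric Literature.Geometry.Symplectic

namespace Summit.SmoothPoincare4.SmoothPoincare4.Theorems.GromovRecognitionRelEnd.CrossCapLaurent

/-- **Chain rule through the chart `z ↦ 1/z`.**  If `h z = g z⁻¹` for `z ≠ 0` and `h` is
differentiable, then for `z ≠ 0`, `Dg_z(w) = Dh_{1/z}(-w/z²)`. [folklore] -/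
theorem fderiv_eq_fderiv_inv_chart {g h : ℂ → ℂ} (hh : Differentiable ℝ h)
    (hgh : ∀ z : ℂ, z ≠ 0 → h z = g z⁻¹) {z : ℂ} (hz0 : z ≠ 0) (w : ℂ) :
    fderiv ℝ g z w = fderiv ℝ h z⁻¹ (-(z ^ 2)⁻¹ * w) := by
  have hev : g =ᶠ[𝓝 z] (h ∘ fun w : ℂ => w⁻¹) := by
    filter_upwards [isOpen_ne.mem_nhds hz0] with w hw
    simp only [Function.comp_apply]
    rw [hgh w⁻¹ (inv_ne_zero hw), inv_inv]
  have hdinv : HasFDerivAt (fun w : ℂ => w⁻¹)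
      ((ContinuousLinearMap.smulRight (1 : ℂ →L[ℂ] ℂ) (-(z ^ 2)⁻¹)).restrictScalars ℝ) z :=
    (hasDerivAt_inv hz0).hasFDerivAt.restrictScalars ℝ
  rw [hev.fderiv_eq, fderiv_comp z (hh z⁻¹) hdinv.differentiableAt, hdinv.fderiv]
  show fderiv ℝ h z⁻¹ (w • -(z ^ 2)⁻¹) = fderiv ℝ h z⁻¹ (-(z ^ 2)⁻¹ * w)
  rw [smul_eq_mul, mul_comm]

/-- **Stub 4c — a smooth map `ℂP¹ → ℂ` with non-negative Jacobian has zero Jacobian (M; pure analysis,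
the Stokes-with-cut-off pattern of `Literature.Geometry.Symplectic.jSphere_const_of_exact_tame`).**
`g, h : ℂ → ℂ` are `C^∞` (real sense) with `h z = g (1/z)` for `z ≠ 0` (the two affine charts of a smooth
map `ℂP¹ → ℂ`), and `det Dg = g^*(dx ∧ dy)(1, i) ≥ 0` everywhere; then `det Dg ≡ 0`.  Proof:
`det Dg · ds∧dt = d(g₁ dg₂)`, `β := g₁ dg₂` is a `C^∞` 1-form on `ℂ` with `|β_z(w)| ≤ C‖w‖/‖z‖²` for
`‖z‖ ≥ 1` (through the chart `z ↦ 1/z`: `g = h ∘ inv` near `∞`, `h` bounded with bounded derivative on the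
unit disc); Stokes on `ℂ` with the cut-off `χ_R` (`Literature.Geometry.GeometricMeasureTheory.integral_extDeriv_apply_eq_zero`)
and `R → ∞` give `∫ det Dg = 0`, so the continuous non-negative `det Dg` vanishes identically
(`extDeriv_apply_eq_zero_of_nonneg_of_decay`, file `PlanarExactDensityDecay.lean`).  Leans on: Mathlib
`fderiv`, `ContDiff`, the two tree lemmas named. [folklore; cite: McDuffSalamon2017, §4.5 (energy identity pattern)] -/
theorem stub_sphereDetVanishes :
    ∀ (g h : ℂ → ℂ), ContDiff ℝ ∞ g → ContDiff ℝ ∞ h → (∀ z : ℂ, z ≠ 0 → h z = g z⁻¹) →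
      (∀ z : ℂ, 0 ≤ (fderiv ℝ g z 1).re * (fderiv ℝ g z Complex.I).im -
          (fderiv ℝ g z 1).im * (fderiv ℝ g z Complex.I).re) →
      ∀ z : ℂ, (fderiv ℝ g z 1).re * (fderiv ℝ g z Complex.I).im -
          (fderiv ℝ g z 1).im * (fderiv ℝ g z Complex.I).re = 0 := by
  intro g h hg hh hgh hdet z₀
  -- the two real components of `g` and their derivatives
  set g₁ : ℂ → ℝ := fun z => Complex.reCLM (g z) with hg₁
  set g₂ : ℂ → ℝ := fun z => Complex.imCLM (g z) with hg₂
  have hg₁s : ContDiff ℝ ∞ g₁ := Complex.reCLM.contDiff.comp hg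
  have hg₂s : ContDiff ℝ ∞ g₂ := Complex.imCLM.contDiff.comp hg
  have hgd : ∀ z, DifferentiableAt ℝ g z := fun z => hg.differentiable (by simp) z
  have hdg₁ : ∀ z w, fderiv ℝ g₁ z w = (fderiv ℝ g z w).re := fun z w => by
    have e : g₁ = Complex.reCLM ∘ g := rfl
    rw [e, (Complex.reCLM.hasFDerivAt.comp z (hgd z).hasFDerivAt).fderiv]
    rfl
  have hdg₂ : ∀ z w, fderiv ℝ g₂ z w = (fderiv ℝ g z w).im := fun z w => by
    have e : g₂ = Complex.imCLM ∘ g := rfl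
    rw [e, (Complex.imCLM.hasFDerivAt.comp z (hgd z).hasFDerivAt).fderiv]
    rfl
  -- the `1`-form `β₀ = dg₂` and its closedness
  set ω₀ : ℂ → ℂ [⋀^Fin 0]→L[ℝ] ℝ := fun z =>
    ContinuousAlternatingMap.constOfIsEmpty ℝ ℂ (Fin 0) (g₂ z) with hω₀
  have hω₀s : ContDiff ℝ ∞ ω₀ :=
    (ContinuousAlternatingMap.constOfIsEmptyLIE ℝ ℂ ℝ (Fin 0)).contDiff.comp hg₂s
  set β₀ : ℂ → ℂ [⋀^Fin 1]→L[ℝ] ℝ := extDeriv ω₀ with hβ₀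
  have hβ₀s : ContDiff ℝ ∞ β₀ := by
    show ContDiff ℝ ∞ fun x =>
      ContinuousAlternatingMap.alternatizeUncurryFinCLM ℝ ℂ ℝ (fderiv ℝ ω₀ x)
    exact (ContinuousAlternatingMap.alternatizeUncurryFinCLM ℝ ℂ ℝ).contDiff.comp
      (hω₀s.fderiv_right (m := ∞) (by simp))
  have hβ₀apply : ∀ z w, β₀ z ![w] = (fderiv ℝ g z w).im := fun z w => by
    rw [hβ₀, hω₀, extDeriv_constOfIsEmpty, ContinuousAlternatingMap.ofSubsingleton_apply_apply,
      ← hdg₂]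
    rfl
  have hdβ₀ : extDeriv β₀ = 0 :=
    extDeriv_extDeriv hω₀s
      (by rw [minSmoothness_of_isRCLikeNormedField]; exact WithTop.coe_le_coe.2 le_top)
  -- the `1`-form `β = g₁ dg₂`
  set β : ℂ → ℂ [⋀^Fin 1]→L[ℝ] ℝ := fun z => g₁ z • β₀ z with hβ
  have hβs : ContDiff ℝ ∞ β := hg₁s.smul hβ₀s
  -- `dβ(1, i) = det Dg`
  have hexp : ∀ z, extDeriv β z ![1, Complex.I] =
      (fderiv ℝ g z 1).re * (fderiv ℝ g z Complex.I).im -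
        (fderiv ℝ g z 1).im * (fderiv ℝ g z Complex.I).re := by
    intro z
    rw [hβ, extDeriv_smul_apply_vec₂ (hg₁s.differentiable (by simp) z)
      (hβ₀s.differentiable (by simp) z), hdβ₀, hβ₀apply, hβ₀apply, hdg₁, hdg₁]
    rw [Pi.zero_apply, ContinuousAlternatingMap.coe_zero, Pi.zero_apply, mul_zero, zero_add]
    ring
  -- bounds for `h` and `Dh` on the closed unit disc
  obtain ⟨A, hA⟩ : ∃ A, ∀ w ∈ closedBall (0 : ℂ) 1, ‖h w‖ ≤ A :=
    (isCompact_closedBall (0 : ℂ) 1).exists_bound_of_continuousOn hh.continuous.continuousOn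
  obtain ⟨B, hB⟩ : ∃ B, ∀ w ∈ closedBall (0 : ℂ) 1, ‖fderiv ℝ h w‖ ≤ B :=
    (isCompact_closedBall (0 : ℂ) 1).exists_bound_of_continuousOn
      (hh.continuous_fderiv (by simp)).continuousOn
  have hA0 : 0 ≤ A := (norm_nonneg _).trans (hA 0 (mem_closedBall_self zero_le_one))
  -- quadratic decay of `β` at infinity, through the chart `z ↦ 1/z`
  have hdecay : ∀ z : ℂ, 1 ≤ ‖z‖ → ∀ w : ℂ, |β z ![w]| ≤ A * B * ‖w‖ / ‖z‖ ^ 2 := by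
    intro z hz w
    have hz0 : z ≠ 0 := by
      rintro rfl
      norm_num at hz
    have hzinv : z⁻¹ ∈ closedBall (0 : ℂ) 1 := by
      rw [mem_closedBall_zero_iff, norm_inv]
      exact inv_le_one_of_one_le₀ hz
    have hgz : g z = h z⁻¹ := by rw [hgh z⁻¹ (inv_ne_zero hz0), inv_inv]
    have h1 : |g₁ z| ≤ A :=
      calc |g₁ z| ≤ ‖g z‖ := Complex.abs_re_le_norm _
        _ = ‖h z⁻¹‖ := by rw [hgz]
        _ ≤ A := hA _ hzinv
    have h2 : |(fderiv ℝ g z w).im| ≤ B * (‖w‖ / ‖z‖ ^ 2) :=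
      calc |(fderiv ℝ g z w).im| ≤ ‖fderiv ℝ g z w‖ := Complex.abs_im_le_norm _
        _ = ‖fderiv ℝ h z⁻¹ (-(z ^ 2)⁻¹ * w)‖ := by
            rw [fderiv_eq_fderiv_inv_chart (hh.differentiable (by simp)) hgh hz0]
        _ ≤ ‖fderiv ℝ h z⁻¹‖ * ‖-(z ^ 2)⁻¹ * w‖ := ContinuousLinearMap.le_opNorm _ _
        _ = ‖fderiv ℝ h z⁻¹‖ * (‖w‖ / ‖z‖ ^ 2) := by
            simp [norm_inv, norm_pow, div_eq_inv_mul]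
        _ ≤ B * (‖w‖ / ‖z‖ ^ 2) := by gcongr; exact hB _ hzinv
    have hβw : β z ![w] = g₁ z * (fderiv ℝ g z w).im := by
      simp only [hβ, ContinuousAlternatingMap.smul_apply, smul_eq_mul, hβ₀apply]
    rw [hβw, abs_mul]
    calc |g₁ z| * |(fderiv ℝ g z w).im| ≤ A * (B * (‖w‖ / ‖z‖ ^ 2)) :=
          mul_le_mul h1 h2 (abs_nonneg _) hA0
      _ = A * B * ‖w‖ / ‖z‖ ^ 2 := by ring
  -- the decay lemma
  have hF : ∀ z, 0 ≤ extDeriv β z ![1, Complex.I] := fun z => by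
    rw [hexp]
    exact hdet z
  have h0 := extDeriv_apply_eq_zero_of_nonneg_of_decay hβs hdecay hF z₀
  rwa [hexp] at h0

end Summit.SmoothPoincare4.SmoothPoincare4.Theorems.GromovRecognitionRelEnd.CrossCapLaurent

end
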